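import Summits.ResolutionOfSingularities.ResolutionOfSingularities.Theorems.FrobeniusLadderFInjectiveMacaulayficationPencilExitSoundnessKit
import HarnessLib

/-!
# TASK 4b: the CHART-GLUING TRANSFER of the pencil blow-up — `FullCl` at a point `(u₀; c)`, `u₀ ≠ 0`, of the `U`-chart `V(B⁺·U − A⁺)` follows from `FullCl` at the point
# `(1/u₀; c)` of the `W`-chart `V(A⁺·W − B⁺)`, via the localisation ring isomorphism `W ↦ 1/U`
# (crux `FInjectiveMacaulayfication` stmt-ResolutionOfSingularities-15315, chain w45a; res-L1-w45a-plan-1 ruling l.85799 (2) «★ the chart-gluing transfer as ONE generic pencil lemma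
# `fullCl_pencilChart_transfer_WU` — preferred over direct u₀ ≠ 0 statements»; consumer res-L1-w45a-stub-3 TASK 4c; seat res-L1-w45a-stub-1 g15)

[OURS · L1 W4.5a] Support file (`--supports stmt-ResolutionOfSingularities-15315 --as helper`); theorems only; unconditional; any field, `A, B ∈ k[y₁..y_n]` ARBITRARY. Nothing of the crux is
proved; no census row is asserted. AI-written (AI review is weaker than expert review).

CONSTRUCTION. `R_W = k[X 0, y]/(A⁺X 0 − B⁺)`, `R_U = k[X 0, y]/(B⁺X 0 − A⁺)`; maximal ideals `P_W ∋ X 0 − w₀`, `P_U ∋ X 0 − u₀` over the same `c`, with `u₀·w₀ = 1`. Since `X 0 ∉ P_U`, its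
image in `(R_U)_{P_U}` is a unit with inverse `ξ`; the substitution `X 0 ↦ ξ, y ↦ y` kills `A⁺X 0 − B⁺` (because `B⁺X 0 = A⁺` in `R_U`), so it descends to `R_W → (R_U)_{P_U}`, and it
sends `P_W` into the maximal ideal (`ξ − w₀ = −ξ·w₀·(X 0 − u₀)`), hence `P_Wᶜ` to units: it extends to `ψ : (R_W)_{P_W} → (R_U)_{P_U}` (§1 `exists_transferHom`, ONE lemma used in both
directions by the symmetry `(A, B, u₀, w₀) ↔ (B, A, w₀, u₀)`). The two transfers are mutually inverse (checked on generators, §2), and `FullCl` is invariant under ring isomorphisms and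
under the stalk isomorphisms `𝒪_{Spec R, y} ≅ R_y` (§3).
* §1 `exists_transferHom`; §2 `transferEquiv_exists`; §3 ★★ `fullCl_pencilChart_transfer_WU` (U-point from W-point), ★★ `fullCl_pencilChart_transfer_UW` (W-point from U-point).
[folklore (gluing of the two standard charts of `Proj` of a two-generated Rees algebra); cite: Fedder1983, Thm. 1.12 (the criterion the charts feed)]
-/

set_option linter.dupNamespace false

noncomputable section

open AlgebraicGeometry IsLocalRing MvPolynomial
open scoped Pointwise

namespace Summit.ResolutionOfSingularities.ResolutionOfSingularities.Theorems.FInjectiveMacaulayfication.PencilChartTransfer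

open Summit.ResolutionOfSingularities.ResolutionOfSingularities.Theorems.FInjectiveMacaulayfication
open SliceableCentre

variable (k : Type) [Field k] {n : ℕ}

/-! ## §1 The one-directional transfer homomorphism -/

set_option maxHeartbeats 800000 in
-- localisation bookkeeping
/-- **THE TRANSFER HOMOMORPHISM** `(R_W)_{P_W} → (R_U)_{P_U}`, `X 0 ↦ (X 0)⁻¹`, `y_i ↦ y_i`, for `R_W = k[X 0, y]/(A⁺X 0 − B⁺)`, `R_U = k[X 0, y]/(B⁺X 0 − A⁺)` and the maximal
ideals over `(w₀; c)`, `(u₀; c)` with `u₀·w₀ = 1`. [folklore chart gluing] -/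
theorem exists_transferHom (A B : MvPolynomial (Fin n) k) (ΦW ΦU : MvPolynomial (Fin (n + 1)) k) (hΦW : ΦW = rename Fin.succ A * X 0 - rename Fin.succ B)
    (hΦU : ΦU = rename Fin.succ B * X 0 - rename Fin.succ A) (u₀ w₀ : k) (huw : u₀ * w₀ = 1) (c : Fin n → k)
    (PW : Ideal (MvPolynomial (Fin (n + 1)) k ⧸ Ideal.span {ΦW})) [PW.IsPrime] (hPWmax : PW.IsMaximal)
    (hPW : PW.comap (Ideal.Quotient.mk _) = Ideal.span (Set.range (Fin.cons ((X 0 : MvPolynomial (Fin (n + 1)) k) - C w₀) fun i : Fin n => X i.succ - C (c i))))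
    (PU : Ideal (MvPolynomial (Fin (n + 1)) k ⧸ Ideal.span {ΦU})) [PU.IsPrime] (hPUmax : PU.IsMaximal)
    (hPU : PU.comap (Ideal.Quotient.mk _) = Ideal.span (Set.range (Fin.cons ((X 0 : MvPolynomial (Fin (n + 1)) k) - C u₀) fun i : Fin n => X i.succ - C (c i)))) :
    ∃ ψ : Localization.AtPrime PW →+* Localization.AtPrime PU,
      (∀ a : k, ψ (algebraMap (MvPolynomial (Fin (n + 1)) k ⧸ Ideal.span {ΦW}) (Localization.AtPrime PW) (Ideal.Quotient.mk (Ideal.span {ΦW}) (C a))) =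
        algebraMap (MvPolynomial (Fin (n + 1)) k ⧸ Ideal.span {ΦU}) (Localization.AtPrime PU) (Ideal.Quotient.mk (Ideal.span {ΦU}) (C a))) ∧
      (∀ i : Fin n, ψ (algebraMap (MvPolynomial (Fin (n + 1)) k ⧸ Ideal.span {ΦW}) (Localization.AtPrime PW) (Ideal.Quotient.mk (Ideal.span {ΦW}) (X i.succ))) =
        algebraMap (MvPolynomial (Fin (n + 1)) k ⧸ Ideal.span {ΦU}) (Localization.AtPrime PU) (Ideal.Quotient.mk (Ideal.span {ΦU}) (X i.succ))) ∧
      ψ (algebraMap (MvPolynomial (Fin (n + 1)) k ⧸ Ideal.span {ΦW}) (Localization.AtPrime PW) (Ideal.Quotient.mk (Ideal.span {ΦW}) (X 0))) *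
        algebraMap (MvPolynomial (Fin (n + 1)) k ⧸ Ideal.span {ΦU}) (Localization.AtPrime PU) (Ideal.Quotient.mk (Ideal.span {ΦU}) (X 0)) = 1 := by
  set F : MvPolynomial (Fin (n + 1)) k →+* Localization.AtPrime PU :=
    (algebraMap (MvPolynomial (Fin (n + 1)) k ⧸ Ideal.span {ΦU}) (Localization.AtPrime PU)).comp (Ideal.Quotient.mk (Ideal.span {ΦU})) with hF
  have hu₀ : u₀ ≠ 0 := by rintro rfl; rw [zero_mul] at huw; exact zero_ne_one huw
  -- generators of `P_U` map into the maximal ideal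
  have hgenU : ∀ g ∈ Set.range (Fin.cons ((X 0 : MvPolynomial (Fin (n + 1)) k) - C u₀) fun i : Fin n => X i.succ - C (c i)), F g ∈ maximalIdeal (Localization.AtPrime PU) := by
    intro g hg
    have hmem : Ideal.Quotient.mk (Ideal.span {ΦU}) g ∈ PU := by
      have : g ∈ PU.comap (Ideal.Quotient.mk _) := by rw [hPU]; exact Ideal.subset_span hg
      exact this
    rw [hF, RingHom.comp_apply]
    exact (IsLocalization.AtPrime.to_map_mem_maximal_iff (Localization.AtPrime PU) PU _).2 hmem
  -- `X 0` is a unit in `L_U`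
  have hX0 : Ideal.Quotient.mk (Ideal.span {ΦU}) (X 0) ∉ PU := by
    intro h
    have h1 : Ideal.Quotient.mk (Ideal.span {ΦU}) (X 0 - C u₀) ∈ PU := by
      have : (X 0 - C u₀ : MvPolynomial (Fin (n + 1)) k) ∈ PU.comap (Ideal.Quotient.mk _) := by rw [hPU]; exact Ideal.subset_span ⟨0, rfl⟩
      exact this
    have h2 : Ideal.Quotient.mk (Ideal.span {ΦU}) (C u₀) ∈ PU := by
      have := PU.sub_mem h h1
      rwa [← map_sub, sub_sub_cancel] at this
    have hunit : IsUnit (Ideal.Quotient.mk (Ideal.span {ΦU}) (C u₀)) := (IsUnit.map C (Ne.isUnit hu₀)).map _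
    exact hPUmax.ne_top (PU.eq_top_of_isUnit_mem h2 hunit)
  have hX0unit : IsUnit (F (X 0)) := by
    rw [hF, RingHom.comp_apply]; exact IsLocalization.map_units (Localization.AtPrime PU) (⟨_, hX0⟩ : PU.primeCompl)
  obtain ⟨ξ, hξ⟩ := hX0unit.exists_left_inv
  -- the substitution
  set φ₀ : MvPolynomial (Fin (n + 1)) k →+* (Localization.AtPrime PU) := eval₂Hom (F.comp C) (Fin.cons ξ fun i : Fin n => F (X i.succ)) with hφ₀
  have hφ₀C : ∀ a : k, φ₀ (C a) = F (C a) := fun a => by rw [hφ₀, eval₂Hom_C, RingHom.comp_apply]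
  have hφ₀X0 : φ₀ (X 0) = ξ := by rw [hφ₀, eval₂Hom_X', Fin.cons_zero]
  have hφ₀Xs : ∀ i : Fin n, φ₀ (X i.succ) = F (X i.succ) := fun i => by rw [hφ₀, eval₂Hom_X', Fin.cons_succ]
  have hφ₀succ : ∀ q : MvPolynomial (Fin n) k, φ₀ (rename Fin.succ q) = F (rename Fin.succ q) := by
    intro q
    have : φ₀.comp (rename Fin.succ : MvPolynomial (Fin n) k →ₐ[k] MvPolynomial (Fin (n + 1)) k).toRingHom =
        F.comp (rename Fin.succ : MvPolynomial (Fin n) k →ₐ[k] MvPolynomial (Fin (n + 1)) k).toRingHom := by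
      refine MvPolynomial.ringHom_ext (fun a => ?_) (fun i => ?_)
      · rw [RingHom.comp_apply, RingHom.comp_apply, AlgHom.toRingHom_eq_coe, RingHom.coe_coe, rename_C, hφ₀C]
      · rw [RingHom.comp_apply, RingHom.comp_apply, AlgHom.toRingHom_eq_coe, RingHom.coe_coe, rename_X, hφ₀Xs]
    exact RingHom.congr_fun this q
  have hrel : F (rename Fin.succ B) * F (X 0) = F (rename Fin.succ A) := by
    have hz : F (rename Fin.succ B * X 0 - rename Fin.succ A) = 0 := by
      rw [← hΦU, hF, RingHom.comp_apply, Ideal.Quotient.eq_zero_iff_mem.2 (Ideal.mem_span_singleton_self _), map_zero]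
    rw [map_sub, map_mul] at hz
    exact sub_eq_zero.1 hz
  have hφ₀Φ : φ₀ ΦW = 0 := by
    rw [hΦW, map_sub, map_mul, hφ₀succ, hφ₀succ, hφ₀X0, ← hrel, mul_assoc, mul_comm (F (X 0)) ξ, hξ, mul_one, sub_self]
  set φ₁ : (MvPolynomial (Fin (n + 1)) k ⧸ Ideal.span {ΦW}) →+* (Localization.AtPrime PU) :=
    Ideal.Quotient.lift (Ideal.span {ΦW}) φ₀ (fun a ha => by
      obtain ⟨t, rfl⟩ := Ideal.mem_span_singleton'.1 ha
      rw [map_mul, hφ₀Φ, mul_zero]) with hφ₁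
  have hφ₁mk : ∀ g, φ₁ (Ideal.Quotient.mk (Ideal.span {ΦW}) g) = φ₀ g := fun g => Ideal.Quotient.lift_mk _ _ _
  -- `P_W` maps into the maximal ideal
  have hgenW : ∀ g ∈ Set.range (Fin.cons ((X 0 : MvPolynomial (Fin (n + 1)) k) - C w₀) fun i : Fin n => X i.succ - C (c i)), φ₀ g ∈ maximalIdeal (Localization.AtPrime PU) := by
    rintro _ ⟨j, rfl⟩
    refine Fin.cases ?_ (fun i => ?_) j
    · rw [Fin.cons_zero, map_sub, hφ₀X0, hφ₀C]
      have h1 : ξ - F (C w₀) = -(ξ * F (C w₀)) * F (X 0 - C u₀) := by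
        have h2 : F (C u₀) * F (C w₀) = 1 := by rw [← map_mul, ← map_mul, huw, C_1, map_one]
        have h3 : -(ξ * F (C w₀)) * (F (X 0) - F (C u₀)) = ξ * (F (C u₀) * F (C w₀)) - F (C w₀) * (ξ * F (X 0)) := by ring
        rw [map_sub, h3, h2, hξ, mul_one, mul_one]
      rw [h1]
      exact Ideal.mul_mem_left _ _ (hgenU _ ⟨0, rfl⟩)
    · rw [Fin.cons_succ, map_sub, hφ₀Xs, hφ₀C, ← map_sub]
      exact hgenU _ ⟨i.succ, by rw [Fin.cons_succ]⟩
  have hPWle : PW ≤ (maximalIdeal (Localization.AtPrime PU)).comap φ₁ := by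
    have hmap : PW = (PW.comap (Ideal.Quotient.mk (Ideal.span {ΦW}))).map (Ideal.Quotient.mk _) :=
      (Ideal.map_comap_of_surjective _ Ideal.Quotient.mk_surjective _).symm
    rw [hmap, hPW, Ideal.map_span, Ideal.span_le]
    rintro _ ⟨g, hg, rfl⟩
    rw [SetLike.mem_coe, Ideal.mem_comap, hφ₁mk]
    exact hgenW g hg
  have hPWeq : (maximalIdeal (Localization.AtPrime PU)).comap φ₁ = PW :=
    (hPWmax.eq_of_le (Ideal.IsPrime.ne_top inferInstance) hPWle).symm
  have hunits : ∀ y : PW.primeCompl, IsUnit (φ₁ y) := by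
    intro y
    by_contra h
    have : (y : MvPolynomial (Fin (n + 1)) k ⧸ Ideal.span {ΦW}) ∈ (maximalIdeal (Localization.AtPrime PU)).comap φ₁ := by
      rw [Ideal.mem_comap]; exact (mem_maximalIdeal _).2 h
    rw [hPWeq] at this
    exact y.2 this
  refine ⟨IsLocalization.lift (M := PW.primeCompl) hunits, fun a => ?_, fun i => ?_, ?_⟩
  · rw [IsLocalization.lift_eq, hφ₁mk, hφ₀C, hF, RingHom.comp_apply]
  · rw [IsLocalization.lift_eq, hφ₁mk, hφ₀Xs, hF, RingHom.comp_apply]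
  · rw [IsLocalization.lift_eq, hφ₁mk, hφ₀X0]
    rw [hF, RingHom.comp_apply] at hξ
    exact hξ

/-! ## §2 The two transfers are mutually inverse -/

set_option maxHeartbeats 800000 in
-- localisation bookkeeping
/-- **THE CHART-GLUING ISOMORPHISM** `(R_W)_{P_W} ≃ (R_U)_{P_U}` (`u₀·w₀ = 1`, same `c`). [folklore chart gluing] -/
theorem transferEquiv_exists (A B : MvPolynomial (Fin n) k) (ΦW ΦU : MvPolynomial (Fin (n + 1)) k) (hΦW : ΦW = rename Fin.succ A * X 0 - rename Fin.succ B)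
    (hΦU : ΦU = rename Fin.succ B * X 0 - rename Fin.succ A) (u₀ w₀ : k) (huw : u₀ * w₀ = 1) (c : Fin n → k)
    (PW : Ideal (MvPolynomial (Fin (n + 1)) k ⧸ Ideal.span {ΦW})) [PW.IsPrime] (hPWmax : PW.IsMaximal)
    (hPW : PW.comap (Ideal.Quotient.mk _) = Ideal.span (Set.range (Fin.cons ((X 0 : MvPolynomial (Fin (n + 1)) k) - C w₀) fun i : Fin n => X i.succ - C (c i))))
    (PU : Ideal (MvPolynomial (Fin (n + 1)) k ⧸ Ideal.span {ΦU})) [PU.IsPrime] (hPUmax : PU.IsMaximal)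
    (hPU : PU.comap (Ideal.Quotient.mk _) = Ideal.span (Set.range (Fin.cons ((X 0 : MvPolynomial (Fin (n + 1)) k) - C u₀) fun i : Fin n => X i.succ - C (c i)))) :
    Nonempty (Localization.AtPrime PW ≃+* Localization.AtPrime PU) := by
  obtain ⟨ψ, hψC, hψX, hψ0⟩ := exists_transferHom k A B ΦW ΦU hΦW hΦU u₀ w₀ huw c PW hPWmax hPW PU hPUmax hPU
  obtain ⟨ψ', hψ'C, hψ'X, hψ'0⟩ := exists_transferHom k B A ΦU ΦW hΦU hΦW w₀ u₀ (by rw [mul_comm]; exact huw) c PU hPUmax hPU PW hPWmax hPW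
  -- inverse units bookkeeping: `ψ' (ψ x₀) = x₀` for the images of `X 0`
  have key : ∀ {R S : Type} [CommRing R] [CommRing S] (f : R →+* S) (x ξ : R) (x' : S), ξ * x = 1 → f x * x' = 1 → f ξ = x' := by
    intro R S _ _ f x ξ x' h1 h2
    have h3 : f ξ * f x = 1 := by rw [← map_mul, h1, map_one]
    calc f ξ = f ξ * (f x * x') := by rw [h2, mul_one]
      _ = (f ξ * f x) * x' := by ring
      _ = x' := by rw [h3, one_mul]
  have h1 : ψ'.comp ψ = RingHom.id _ := by
    refine IsLocalization.ringHom_ext (M := PW.primeCompl) (Ideal.Quotient.ringHom_ext (MvPolynomial.ringHom_ext (fun a => ?_) (fun j => ?_)))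
    · simp only [RingHom.comp_apply, RingHom.id_apply]; rw [hψC, hψ'C]
    · simp only [RingHom.comp_apply, RingHom.id_apply]
      refine Fin.cases ?_ (fun i => ?_) j
      · exact key ψ' (algebraMap (MvPolynomial (Fin (n + 1)) k ⧸ Ideal.span {ΦU}) (Localization.AtPrime PU) (Ideal.Quotient.mk (Ideal.span {ΦU}) (X 0))) (ψ (algebraMap (MvPolynomial (Fin (n + 1)) k ⧸ Ideal.span {ΦW}) (Localization.AtPrime PW) (Ideal.Quotient.mk (Ideal.span {ΦW}) (X 0)))) (algebraMap (MvPolynomial (Fin (n + 1)) k ⧸ Ideal.span {ΦW}) (Localization.AtPrime PW) (Ideal.Quotient.mk (Ideal.span {ΦW}) (X 0))) hψ0 hψ'0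
      · rw [hψX, hψ'X]
  have h2 : ψ.comp ψ' = RingHom.id _ := by
    refine IsLocalization.ringHom_ext (M := PU.primeCompl) (Ideal.Quotient.ringHom_ext (MvPolynomial.ringHom_ext (fun a => ?_) (fun j => ?_)))
    · simp only [RingHom.comp_apply, RingHom.id_apply]; rw [hψ'C, hψC]
    · simp only [RingHom.comp_apply, RingHom.id_apply]
      refine Fin.cases ?_ (fun i => ?_) j
      · exact key ψ (algebraMap (MvPolynomial (Fin (n + 1)) k ⧸ Ideal.span {ΦW}) (Localization.AtPrime PW) (Ideal.Quotient.mk (Ideal.span {ΦW}) (X 0))) (ψ' (algebraMap (MvPolynomial (Fin (n + 1)) k ⧸ Ideal.span {ΦU}) (Localization.AtPrime PU) (Ideal.Quotient.mk (Ideal.span {ΦU}) (X 0)))) (algebraMap (MvPolynomial (Fin (n + 1)) k ⧸ Ideal.span {ΦU}) (Localization.AtPrime PU) (Ideal.Quotient.mk (Ideal.span {ΦU}) (X 0))) hψ'0 hψ0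
      · rw [hψ'X, hψX]
  exact ⟨RingEquiv.ofRingHom ψ ψ' h2 h1⟩

/-! ## §3 ★★ `FullCl` transfers between the two charts -/

/-- ★★ **`FullCl` AT A `U`-CHART POINT WITH `U = u₀ ≠ 0` FROM THE `W`-CHART POINT `W = u₀⁻¹`** (same base coordinates `c`; `A, B` arbitrary): the consumer proves FULL on the `W`-chart
at every `w₀` (✓ the per-code family) and at the pole `U = 0`, and transfers to the rest of the `U`-chart with this lemma. [OURS · TASK 4b; folklore chart gluing] -/
theorem fullCl_pencilChart_transfer_WU (p : ℕ) (A B : MvPolynomial (Fin n) k) (ΦW ΦU : MvPolynomial (Fin (n + 1)) k) (hΦW : ΦW = rename Fin.succ A * X 0 - rename Fin.succ B)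
    (hΦU : ΦU = rename Fin.succ B * X 0 - rename Fin.succ A) (c : Fin n → k) (u₀ : k) (hu₀ : u₀ ≠ 0)
    (yU : Spec (.of (MvPolynomial (Fin (n + 1)) k ⧸ Ideal.span {ΦU}))) (hyU : yU.asIdeal.IsMaximal)
    (haU : yU.asIdeal.comap (Ideal.Quotient.mk _) = Ideal.span (Set.range (Fin.cons ((X 0 : MvPolynomial (Fin (n + 1)) k) - C u₀) fun i : Fin n => X i.succ - C (c i))))
    (yW : Spec (.of (MvPolynomial (Fin (n + 1)) k ⧸ Ideal.span {ΦW}))) (hyW : yW.asIdeal.IsMaximal)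
    (haW : yW.asIdeal.comap (Ideal.Quotient.mk _) = Ideal.span (Set.range (Fin.cons ((X 0 : MvPolynomial (Fin (n + 1)) k) - C u₀⁻¹) fun i : Fin n => X i.succ - C (c i))))
    (hW : FullCl p ((Spec (.of (MvPolynomial (Fin (n + 1)) k ⧸ Ideal.span {ΦW}))).presheaf.stalk yW)) :
    FullCl p ((Spec (.of (MvPolynomial (Fin (n + 1)) k ⧸ Ideal.span {ΦU}))).presheaf.stalk yU) := by
  obtain ⟨e⟩ := transferEquiv_exists k A B ΦW ΦU hΦW hΦU u₀ u₀⁻¹ (mul_inv_cancel₀ hu₀) c yW.asIdeal hyW haW yU.asIdeal hyU haU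
  have h1 : FullCl p (Localization.AtPrime yW.asIdeal) :=
    WFixAtNonClosedDimTwo.fullCl_of_ringEquiv p (Spec.stalkIso (.of _) yW).commRingCatIsoToRingEquiv hW
  have e' : Localization.AtPrime yW.asIdeal ≃+* Localization.AtPrime yU.asIdeal := e
  have h2 : FullCl p (Localization.AtPrime yU.asIdeal) := WFixAtNonClosedDimTwo.fullCl_of_ringEquiv p e' h1
  exact WFixAtNonClosedDimTwo.fullCl_of_ringEquiv p (Spec.stalkIso (.of _) yU).commRingCatIsoToRingEquiv.symm h2

/-- ★★ **`FullCl` AT A `W`-CHART POINT WITH `W = w₀ ≠ 0` FROM THE `U`-CHART POINT `U = w₀⁻¹`** (the symmetric direction). [OURS · TASK 4b; folklore chart gluing] -/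
theorem fullCl_pencilChart_transfer_UW (p : ℕ) (A B : MvPolynomial (Fin n) k) (ΦW ΦU : MvPolynomial (Fin (n + 1)) k) (hΦW : ΦW = rename Fin.succ A * X 0 - rename Fin.succ B)
    (hΦU : ΦU = rename Fin.succ B * X 0 - rename Fin.succ A) (c : Fin n → k) (w₀ : k) (hw₀ : w₀ ≠ 0)
    (yW : Spec (.of (MvPolynomial (Fin (n + 1)) k ⧸ Ideal.span {ΦW}))) (hyW : yW.asIdeal.IsMaximal)
    (haW : yW.asIdeal.comap (Ideal.Quotient.mk _) = Ideal.span (Set.range (Fin.cons ((X 0 : MvPolynomial (Fin (n + 1)) k) - C w₀) fun i : Fin n => X i.succ - C (c i))))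
    (yU : Spec (.of (MvPolynomial (Fin (n + 1)) k ⧸ Ideal.span {ΦU}))) (hyU : yU.asIdeal.IsMaximal)
    (haU : yU.asIdeal.comap (Ideal.Quotient.mk _) = Ideal.span (Set.range (Fin.cons ((X 0 : MvPolynomial (Fin (n + 1)) k) - C w₀⁻¹) fun i : Fin n => X i.succ - C (c i))))
    (hU : FullCl p ((Spec (.of (MvPolynomial (Fin (n + 1)) k ⧸ Ideal.span {ΦU}))).presheaf.stalk yU)) :
    FullCl p ((Spec (.of (MvPolynomial (Fin (n + 1)) k ⧸ Ideal.span {ΦW}))).presheaf.stalk yW) :=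
  fullCl_pencilChart_transfer_WU k p B A ΦU ΦW hΦU hΦW c w₀ hw₀ yW hyW haW yU hyU haU hU

end Summit.ResolutionOfSingularities.ResolutionOfSingularities.Theorems.FInjectiveMacaulayfication.PencilChartTransfer

end
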